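import Summits.HodgeConjecture.HodgeConjecture.Theorems.F0LD2ThetaChiDescent
import Summits.HodgeConjecture.HodgeConjecture.Theorems.F0LD2ThetaFinIntertwiner
import Summits.HodgeConjecture.HodgeConjecture.Theorems.F0LD2FrameTransportPin
import Summits.HodgeConjecture.HodgeConjecture.Theorems.F0LD2CurveHolTestVector
import Literature.NumberTheory.Automorphic.Liu2021.Def411WeilCarriersIrreducibleOrZeroAtLine
import Literature.NumberTheory.Automorphic.DiscreteAutomorphicRepHasFinComponentOfIrreducible
import Literature.NumberTheory.Automorphic.UnitaryGroupDatumScaleInvariance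
import Literature.NumberTheory.Automorphic.AdelicUnitaryGroupDatum
import Literature.NumberTheory.Automorphic.UnitaryGroupArchSection
import HarnessLib

-- As in the lineage (`ThetaLiftFromLineFinIntertwiner`, `F0LD2ThetaFinIntertwiner`): statements over the theta-kernel datum elaborate to very large
-- types; elaborate sequentially.
set_option Elab.async false

/-!
# Crux `HLiu418`, line LD2 (`stub_S1b_facts` in-house) — ORGAN B₂ `ThetaFinComponent₂` PAID:
# `P` meets the theta lift from `⟨a′⟩` along the pinned transport and is holomorphic-cotangent ⇒ `ω(μ′, ε_{a′}, χ′)_f ≠ 0` and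
# `P.HasFinComponent (ω(μ′, ε_{a′}, χ′)_f ∘ (g_f⁻¹ · g_f))` for a GENUINE `χ′ ∈ Chi`

Cell hodgecm-mathlib (D-0151), FLOOR 0; crux item `HLiu418` = stmt-HodgeConjecture-24832 (socket `Cruxes/HLiu418/Lines/F0_AlbCm.lean :249`
`stub_S1b_facts : Rogawski1990.curveThetaHodgeTypeNecessity_hol`); half-A line LD2, skeleton `F0/P6/LD/LD2-plan/g0/StubS1bfacts.inhouse.skeleton.v5.lean`
(sha16 e8da573259aec245, boxed by LD-ref1 (g0) 03:20:55Z), organ B₂ = `def ThetaFinComponent₂` (:202) ∕ `stub_thetaFinComponent₂` (:513).  Seat LD2-p02 (g0).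
THEOREMS ONLY (no `def`, no instance, no notation, no named fact, no `sorry`); `--supports stmt-HodgeConjecture-24832`.

`thetaFinComponent₂_holds` states the body of `ThetaFinComponent₂` TOKEN FOR TOKEN (the skeleton closes its stub by `:= thetaFinComponent₂_holds`).
It is node B of [Liu2021, proof of Prop. 4.13 Case 1] («In other words … `π^∞ ≃ ω(μ, ε_e, χ)`») at `n = 2`, in the frame of the curve letters
(#74: scaled rational frame `formCongr c g (t • H) = diag dV`, transport `ιA` pinned by `↑(ιA k) = g_𝔸⁻¹ k g_𝔸`), assembled from the seat's kernel kit: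

1. `[U(H)]` is compact: `diag dV` is definite at a complex place `τ′ ≠ ι` (there is one, `4 ≤ [L:ℚ]`, ★ `exists_infinitePlace_ne`), so `H` is anisotropic
   (★ `anisotropic_of_formCongr_smul_eq_of_posDef`) and ★ `compactSpace_adelicGroupData_automorphicQuotient`.
2. the pinned `ιA` is continuous and carries rational points to rational points (★ `F0LD2FrameTransportPin.continuous_of_pin`, `…mem_range_toAdelic_of_pin`),
   and `ιA (1,k) = (1, (ιA (1,k))_f)` (★ `…pin_finAdelicToAdelic`); its finite part IS `(finAdelicCongr … g ht hg).symm` (★ `…finPart_pin_eq_finAdelicCongr_symm`).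
3. test vector: `P ∋ [f] ≠ 0`, `f ∈ holCotForms₂ … (cmPlace L ι) 𝔣` (★ `F0LD2CurveHolTestVector.exists_toLp_ne_zero_of_isHolCotangentAt₂`).
4. χ-descent, then a PURE TENSOR: ★ `F0LD2ThetaChiDescent.exists_chi_starProjection_ne_zero_of_holCotForm₂` + ★
   `F0LD2ThetaTensorClasses.exists_tensor_of_apply_toLp_lineThetaLift_ne_zero` — `pr_P [Θ̃_{Φ_∞ ⊗ Φ_f}(charCM (chiQuot a′ χ′)) ∘ ιA] ≠ 0` for a `χ′ ∈ Chi`.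
5. the finite theta intertwiner `θ̄_{Φ_∞} : rhoAtLine … (finPart ∘ ιA ∘ (1,·)) a′ χ′ ⟶ P.finRep` (★ `F0LD2ThetaFinIntertwiner.exists_intertwiningMap_rhoAtLine_finRep`)
   is non-zero at `mk Φ_f` (so the carrier `omegaAtLine … a′ χ′` is `Nontrivial`), the source is irreducible-or-zero ([Liu2021, Lem. D.1]: ★
   `isIrreducibleOrZero_rhoVAtLine_chiSplittingLine_comp_of_surjective`, `2 ≤ n′`, the finite transport is onto), hence `θ̄_{Φ_∞}` is injective
   (★ `DiscreteAutomorphicRep.hasFinComponent_of_isIrreducibleOrZero`); finally `finPart ∘ ιA ∘ (1,·) = (finAdelicCongr … g ht hg).symm` as monoid maps.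

HONEST LABEL: HC_CM is proved only modulo the 7 printed citations (2 remaining: hLiu418 = stmt-HodgeConjecture-24832, h413 = stmt-HodgeConjecture-24833)
until rung 0 closes; this file discharges none of them (it pays organ B₂ of the in-house line LD2 toward `stub_S1b_facts`).

## References
* [Liu2021] Y. Liu, Camb. J. Math. 9 (2021) = arXiv:2102.11518: Def. 4.11 (l. 2090–2096, p. 46); proof of Prop. 4.13 Case 1 (l. 2131–2137, p. 48);
  App. D §D.1 Step 3 (l. 5221), Lemma D.1 (l. 5227), proof of Prop. D.4 (1) (p. 131).
* [Rallis1984] S. Rallis, Compositio Math. 51 (1984), Thm. 1.2.2 proof p. 356.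
* [GelbartRogawski1991] S. Gelbart, J. Rogawski, Invent. Math. 105 (1991), §3.2 p. 457.
* [BorelJacquet1979] A. Borel, H. Jacquet, PSPM 33.1 (1979), §4.6.
* [PlatonovRapinchuk1994] V. Platonov, A. Rapinchuk, Academic Press (1994), §2.3; §5.3 Thm. 5.5.
-/

set_option autoImplicit false
-- the mandated namespace has the single-problem summit's repeated segment (`HodgeConjecture.HodgeConjecture`)
set_option linter.dupNamespace false

noncomputable section

open NumberField NumberField.InfinitePlace MeasureTheory IsDedekindDomain
open scoped Matrix Kronecker ComplexOrder ENNReal SchwartzMap TensorProduct Classical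

namespace Summit.HodgeConjecture.HodgeConjecture.Cruxes.HLiu418.F0LD2ThetaFinComponent

open _root_.MeasureTheory
open Literature.NumberTheory.Automorphic Literature.NumberTheory.Automorphic.UnitaryGroup
open Literature.NumberTheory.Automorphic.UnitaryGroup.CotangentForms
open Literature.NumberTheory.Automorphic.UnitaryCurveForms
open Literature.NumberTheory.Automorphic.IdeleClassGroup
open Literature.NumberTheory.Automorphic.Liu2021
open Literature.NumberTheory.Automorphic.Liu2021.Def411WeilCarriers
open Literature.NumberTheory.Automorphic.Liu2021.Def411WeilCarriersDoubling
open Literature.NumberTheory.GelbartRogawski1991 Literature.NumberTheory.GelbartRogawski1991.UnitaryDualPair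
open Literature.NumberTheory.GelbartRogawski1991.UnitaryDualPair.WeilCoinv
open Literature.NumberTheory.Weil1964
open Literature.RepresentationTheory Literature.RepresentationTheory.Liu2021
open Literature.RepresentationTheory.CompactGroups
open Literature.RepresentationTheory.HeisenbergGroup
open Summit.HodgeConjecture.HodgeConjecture.Cruxes.HLiu418.F0LD1ThetaTransportKit
open Summit.HodgeConjecture.HodgeConjecture.Cruxes.HLiu418.F0LD2ThetaTensorClasses
open Summit.HodgeConjecture.HodgeConjecture.Cruxes.HLiu418.F0LD2ThetaFinIntertwiner
open Summit.HodgeConjecture.HodgeConjecture.Cruxes.HLiu418.F0LD2ThetaChiDescent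
open Summit.HodgeConjecture.HodgeConjecture.Cruxes.HLiu418.F0LD2FrameTransportPin
open Summit.HodgeConjecture.HodgeConjecture.Cruxes.HLiu418.F0LD2CurveHolTestVector

/-! ## Organ B₂ `ThetaFinComponent₂` — the body of the skeleton's `def`, token for token -/

/-- `2 ≤ n'` for `e₁ : Fin 2 × Fin 1 ≃ Fin n'` (`n' = 2`; the rank hypothesis of ★ `isIrreducibleOrZero_rhoVAtLine_chiSplittingLine`). [folklore] -/
private theorem two_le_of_equiv_fin_two {n' : ℕ} (e₁ : Fin 2 × Fin 1 ≃ Fin n') : 2 ≤ n' := by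
  have h := Fintype.card_congr e₁
  simp only [Fintype.card_prod, Fintype.card_fin] at h
  omega

set_option maxHeartbeats 3200000 in
/-- **ORGAN B₂ `ThetaFinComponent₂` (LD2 skeleton v5 :202) PAID** — [Liu2021, proof of Prop. 4.13 Case 1 + Prop. D.4 (1)] node B at `n = 2` along the
letters' pinned transport: if the discrete automorphic `P` of the CM unitary curve `U(H)` MEETS the theta lift from the hermitian line `⟨a′⟩` at the
`μ′`-splitting along `ιA` (`MeetsThetaLiftFromLine … P μ′ hμ′ a′ ιA`) and is holomorphic-cotangent at `ι` in the cone frame `𝔣` (`IsHolCotangentAt₂`), then for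
some `χ′ ∈ Chi L⁺ L c̄` the finite carrier `ω(μ′, ε_{a′}, χ′)_f = omegaAtLine … a′ χ′` is NON-ZERO and
`P.HasFinComponent (ω(μ′, ε_{a′}, χ′)_f ∘ (finAdelicCongr … g ht hg).symm)`.  Assembly = steps 1–5 of the module docstring.
[cite: Liu2021, App. D §D.1 Step 3 (l. 5221); proof of Prop. 4.13 Case 1 (l. 2136–2137, p. 48); Def. 4.11 (l. 2092–2096, p. 46); App. D Lemma D.1 (l. 5227)]
[cite: Rallis1984, Thm. 1.2.2 proof p. 356] [cite: GelbartRogawski1991, §3.2 p. 457] [cite: BorelJacquet1979, §4.6] [cite: PlatonovRapinchuk1994, §5.3 Thm. 5.5] -/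
theorem thetaFinComponent₂_holds :
  ∀ (L : Type) [Field L] [NumberField L] [IsCMField L] (ι : L →+* ℂ) (H : Matrix (Fin 2) (Fin 2) L)
    (dV : Fin 2 → L) (hdV : ∀ i, IsCMField.complexConj L (dV i) = dV i) (hdV0 : ∀ i, dV i ≠ 0)
    (t : L) (ht : t ≠ 0) (g : GL (Fin 2) L)
    (hg : formCongr ((IsCMField.complexConj L : L ≃ₐ[↥(maximalRealSubfield L)] L) : L →+* L) g (t • H) = Matrix.diagonal dV),
    (∃ T : GL (Fin 2) ℂ, formCongr (starRingEnd ℂ) T ((Matrix.diagonal dV).map ι) = Matrix.diagonal ![(1 : ℂ), -1]) →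
    (∀ τ' : L →+* ℂ, InfinitePlace.mk τ' ≠ InfinitePlace.mk ι → ((Matrix.diagonal dV).map τ').PosDef) →
    4 ≤ Module.finrank ℚ L →
    ∀ (𝔣 : ConeFrame L H (cmPlace L ι))
      (μ : Measure (adelicGroupData (↥(maximalRealSubfield L)) L (IsCMField.complexConj L) 2 H).automorphicQuotient)
      [(adelicGroupData (↥(maximalRealSubfield L)) L (IsCMField.complexConj L) 2 H).IsAutomorphicMeasure μ]
      {n' : ℕ} (e₁ : Fin 2 × Fin 1 ≃ Fin n')
      (ιA : (adelicGroupData (↥(maximalRealSubfield L)) L (IsCMField.complexConj L) 2 H).Adelic →*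
        ↥(UnitaryGroup.adelic (↥(maximalRealSubfield L)) L (IsCMField.complexConj L) 2 (Matrix.diagonal dV))),
      (∀ k, ((ιA k : ↥(UnitaryGroup.adelic (↥(maximalRealSubfield L)) L (IsCMField.complexConj L) 2 (Matrix.diagonal dV))) :
            GL (Fin 2) (AdeleRing (𝓞 L) L)) =
          (toAdeleGL L g)⁻¹ * adelicVal (↥(maximalRealSubfield L)) L (IsCMField.complexConj L) 2 H k * toAdeleGL L g) →
    ∀ [CompactSpace (↥(UnitaryGroup.adelic (↥(maximalRealSubfield L)) L (IsCMField.complexConj L) 2 (Matrix.diagonal dV)) ⧸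
        (UnitaryGroup.toAdelic (↥(maximalRealSubfield L)) L (IsCMField.complexConj L) 2 (Matrix.diagonal dV)).range)],
    ∀ (P : DiscreteAutomorphicRep (adelicGroupData (↥(maximalRealSubfield L)) L (IsCMField.complexConj L) 2 H) μ)
      (μ' : Literature.NumberTheory.Automorphic.IdeleClassGroup L →ₜ* Circle) (hμ' : IsConjugateSymplectic L μ')
      (a' : (↥(maximalRealSubfield L))ˣ),
      MeetsThetaLiftFromLine L 2 H e₁ dV hdV hdV0 P μ' hμ' a' ιA →
      P.IsHolCotangentAt₂ (IsCMField.complexConj_ne_one L) (UnitaryGroup.complexConj_smul_infinitePlace L) (cmPlace L ι) 𝔣 →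
      ∃ χ' : Chi (↥(maximalRealSubfield L)) L (IsCMField.complexConj L),
        Nontrivial
          (omegaAtLine (↥(maximalRealSubfield L)) L (IsCMField.complexConj L) 2 e₁ (Matrix.diagonal dV)
            (complexConj_imagUnit L) (imagUnit_ne_zero L) (imagUnit_mul_self L) (realDiagonal_isSymm L dV hdV)
            (isUnit_det_realDiagonal L dV hdV hdV0) (realDiagonal_map L dV hdV).symm
            (fun a => isCompatible_chiSplittingLine L e₁ dV hdV hdV0 (toHeckeCharacter L μ')
              (isUnitary_toHeckeCharacter L μ') ((isOscillatorChar_toHeckeCharacter_iff μ').mpr hμ')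
              (TW (↥(maximalRealSubfield L)) a) (isSymm_TW (↥(maximalRealSubfield L)) a)
              (isUnit_det_TW (↥(maximalRealSubfield L)) a) (JW (↥(maximalRealSubfield L)) L a)
              (JW_eq (↥(maximalRealSubfield L)) L a)) a' χ') ∧
        P.HasFinComponent
          ((rhoVAtLine (↥(maximalRealSubfield L)) L (IsCMField.complexConj L) 2 e₁ (Matrix.diagonal dV)
              (complexConj_imagUnit L) (imagUnit_ne_zero L) (imagUnit_mul_self L) (realDiagonal_isSymm L dV hdV)
              (isUnit_det_realDiagonal L dV hdV hdV0) (realDiagonal_map L dV hdV).symm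
              (fun a => isCompatible_chiSplittingLine L e₁ dV hdV hdV0 (toHeckeCharacter L μ')
                (isUnitary_toHeckeCharacter L μ') ((isOscillatorChar_toHeckeCharacter_iff μ').mpr hμ')
                (TW (↥(maximalRealSubfield L)) a) (isSymm_TW (↥(maximalRealSubfield L)) a)
                (isUnit_det_TW (↥(maximalRealSubfield L)) a) (JW (↥(maximalRealSubfield L)) L a)
                (JW_eq (↥(maximalRealSubfield L)) L a)) a' χ').comp
            (finAdelicCongr (↥(maximalRealSubfield L)) L (IsCMField.complexConj L) g ht hg).symm.toMonoidHom) := by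
  intro L _ _ _ ι H dV hdV hdV0 t ht g hg _hT hpos h4 𝔣 μ _ n' e₁ ιA hpin _ P μ' hμ' a' hmeets hhol
  -- 1. `[U(H)]` is compact
  haveI : CompactSpace (adelicGroupData (↥(maximalRealSubfield L)) L (IsCMField.complexConj L) 2 H).automorphicQuotient := by
    obtain ⟨τ, hτ⟩ := UnitaryGroup.exists_infinitePlace_ne L h4 ι
    exact UnitaryGroup.compactSpace_adelicGroupData_automorphicQuotient L 2 H
      (UnitaryGroup.anisotropic_of_formCongr_smul_eq_of_posDef L 2 H dV t ht g hg τ (hpos τ hτ))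
  -- 2. the pinned transport: continuous, rational-to-rational, finite-adelic on finite-adelic points
  have hιA : Continuous ιA ∧ ∀ ⦃γ : (adelicGroupData (↥(maximalRealSubfield L)) L (IsCMField.complexConj L) 2 H).Adelic⦄,
      γ ∈ (UnitaryGroup.toAdelic (↥(maximalRealSubfield L)) L (IsCMField.complexConj L) 2 H).range →
        ιA γ ∈ (UnitaryGroup.toAdelic (↥(maximalRealSubfield L)) L (IsCMField.complexConj L) 2 (Matrix.diagonal dV)).range :=
    ⟨continuous_of_pin L 2 H dV g ιA hpin, fun _ hγ => mem_range_toAdelic_of_pin L 2 H dV t ht g hg ιA hpin hγ⟩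
  have hιAf : ∀ k, ιA (finAdelicToAdelic (↥(maximalRealSubfield L)) L (IsCMField.complexConj L) 2 H k) =
      finAdelicToAdelic (↥(maximalRealSubfield L)) L (IsCMField.complexConj L) 2 (Matrix.diagonal dV)
        (finPart (↥(maximalRealSubfield L)) L (IsCMField.complexConj L) 2 (Matrix.diagonal dV)
          (ιA (finAdelicToAdelic (↥(maximalRealSubfield L)) L (IsCMField.complexConj L) 2 H k))) := fun k => by
    rw [finPart_pin_eq_finAdelicCongr_symm L 2 H dV t ht g hg ιA hpin k]
    exact pin_finAdelicToAdelic L 2 H dV t ht g hg ιA hpin k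
  have hιV : (finPart (↥(maximalRealSubfield L)) L (IsCMField.complexConj L) 2 (Matrix.diagonal dV)).comp
        (ιA.comp (finAdelicToAdelic (↥(maximalRealSubfield L)) L (IsCMField.complexConj L) 2 H)) =
      (finAdelicCongr (↥(maximalRealSubfield L)) L (IsCMField.complexConj L) g ht hg).symm.toMonoidHom :=
    MonoidHom.ext fun k => by
      show finPart (↥(maximalRealSubfield L)) L (IsCMField.complexConj L) 2 (Matrix.diagonal dV)
          (ιA (finAdelicToAdelic (↥(maximalRealSubfield L)) L (IsCMField.complexConj L) 2 H k)) =
        (finAdelicCongr (↥(maximalRealSubfield L)) L (IsCMField.complexConj L) g ht hg).symm k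
      exact finPart_pin_eq_finAdelicCongr_symm L 2 H dV t ht g hg ιA hpin k
  have hsurj : Function.Surjective ((finPart (↥(maximalRealSubfield L)) L (IsCMField.complexConj L) 2 (Matrix.diagonal dV)).comp
      (ιA.comp (finAdelicToAdelic (↥(maximalRealSubfield L)) L (IsCMField.complexConj L) 2 H))) := by
    rw [hιV]
    exact (finAdelicCongr (↥(maximalRealSubfield L)) L (IsCMField.complexConj L) g ht hg).symm.surjective
  -- 3. the test vector
  obtain ⟨f, hf, h, hmem, hne⟩ := exists_toLp_ne_zero_of_isHolCotangentAt₂ (μ := μ) P hhol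
  -- 4. χ-descent on a pure tensor
  letI : MeasurableSpace (↥(UnitaryGroup.adelic (↥(maximalRealSubfield L)) L (IsCMField.complexConj L) 1 (JW (↥(maximalRealSubfield L)) L a')) ⧸
      (UnitaryGroup.toAdelic (↥(maximalRealSubfield L)) L (IsCMField.complexConj L) 1 (JW (↥(maximalRealSubfield L)) L a')).range) := borel _
  haveI : BorelSpace (↥(UnitaryGroup.adelic (↥(maximalRealSubfield L)) L (IsCMField.complexConj L) 1 (JW (↥(maximalRealSubfield L)) L a')) ⧸
      (UnitaryGroup.toAdelic (↥(maximalRealSubfield L)) L (IsCMField.complexConj L) 1 (JW (↥(maximalRealSubfield L)) L a')).range) := ⟨rfl⟩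
  haveI := normal_range_toAdelic_JW L a'
  obtain ⟨hρ, μW, hfinm, hinv, Φ, χ', hθ, hχ⟩ :=
    exists_chi_starProjection_ne_zero_of_holCotForm₂ L H e₁ dV hdV hdV0 g ιA hιA hpin P hf h hmem hne μ' hμ' a' hmeets
  haveI : IsFiniteMeasure μW := hfinm
  haveI : SMulInvariantMeasure ↥(UnitaryGroup.adelic (↥(maximalRealSubfield L)) L (IsCMField.complexConj L) 1 (JW (↥(maximalRealSubfield L)) L a'))
      (↥(UnitaryGroup.adelic (↥(maximalRealSubfield L)) L (IsCMField.complexConj L) 1 (JW (↥(maximalRealSubfield L)) L a')) ⧸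
        (UnitaryGroup.toAdelic (↥(maximalRealSubfield L)) L (IsCMField.complexConj L) 1 (JW (↥(maximalRealSubfield L)) L a')).range) μW := hinv
  -- the seam's `MemLp` witness is proof-irrelevant: read it as the uniform one, then reduce to a PURE TENSOR `Φ_∞ ⊗ Φ_f`
  have hχ' : (P.space.toSubmodule.starProjection : Lp ℂ 2 μ →ₗ[ℂ] Lp ℂ 2 μ)
      (MemLp.toLp _ (memLp_toQuotFun_lineThetaLift L 2 H e₁ dV hdV hdV0 ιA hιA μ' hμ' a' hρ μW Φ
        (charCM (chiQuot (↥(maximalRealSubfield L)) L (IsCMField.complexConj L) (Algebra.IsQuadraticExtension.finrank_eq_two _ L)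
          (IsCMField.complexConj_ne_one (K := L)) a' χ')) μ 2)) ≠ 0 := hχ
  obtain ⟨Φinf, Φfin, hfin, hneT⟩ := exists_tensor_of_apply_toLp_lineThetaLift_ne_zero L 2 H e₁ dV hdV hdV0 ιA hιA μ' hμ' a' hρ μW
    (charCM (chiQuot (↥(maximalRealSubfield L)) L (IsCMField.complexConj L) (Algebra.IsQuadraticExtension.finrank_eq_two _ L)
      (IsCMField.complexConj_ne_one (K := L)) a' χ')) μ
    (P.space.toSubmodule.starProjection : Lp ℂ 2 μ →ₗ[ℂ] Lp ℂ 2 μ) Φ hχ'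
  -- the witness `Φ_∞ ⊗ Φ_f`, read in the Kronecker currency of the finite Weil representation
  have hΨ : piSBReindex (↥(maximalRealSubfield L)) e₁ (piSchwartzBruhatEquiv (↥(maximalRealSubfield L)) (Fin 2 × Fin 1)
        (schwartzReindexCLM (↥(maximalRealSubfield L)) e₁.symm Φinf ⊗ₜ[ℂ] finSBReindex (↥(maximalRealSubfield L)) e₁.symm ⟨Φfin, hfin⟩)) =
      ⟨fun v => Φinf (piArch (↥(maximalRealSubfield L)) (Fin n') v) * Φfin (piFinite (↥(maximalRealSubfield L)) (Fin n') v),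
        tensor_mem_piSchwartzBruhat Φinf hfin⟩ := by
    rw [piSBReindex_tmul, schwartzReindexCLM_schwartzReindexCLM_symm, ← finSBReindex_symm, LinearEquiv.apply_symm_apply]
    exact Subtype.ext (coe_piSchwartzBruhatEquiv_tmul (↥(maximalRealSubfield L)) (Fin n') Φinf ⟨Φfin, hfin⟩)
  -- 5. the finite theta intertwiner, non-zero at `mk Φ_f`, from an irreducible-or-zero source
  obtain ⟨θ, hθv⟩ := exists_intertwiningMap_rhoAtLine_finRep L 2 H e₁ dV hdV hdV0 ιA hιA μ' hμ' a' hρ μW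
    (schwartzReindexCLM (↥(maximalRealSubfield L)) e₁.symm Φinf) P χ' hιAf
  have hw : θ (TwistedCoinv.mk _ _ (finSBReindex (↥(maximalRealSubfield L)) e₁.symm ⟨Φfin, hfin⟩)) ≠ 0 := by
    intro h0
    apply hneT
    have h1 := hθv (finSBReindex (↥(maximalRealSubfield L)) e₁.symm ⟨Φfin, hfin⟩)
    rw [h0, toLp_lineThetaLift_congr L 2 H e₁ dV hdV hdV0 ιA hιA μ' hμ' a' hρ μW _ μ hΨ] at h1
    exact h1.symm.trans (ZeroMemClass.coe_zero _)
  have hirr := isIrreducibleOrZero_rhoVAtLine_chiSplittingLine_comp_of_surjective L e₁ (two_le_of_equiv_fin_two e₁) dV hdV hdV0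
    (toHeckeCharacter L μ') (isUnitary_toHeckeCharacter L μ') ((isOscillatorChar_toHeckeCharacter_iff μ').mpr hμ') a' χ' _ hsurj
  have key := P.hasFinComponent_of_isIrreducibleOrZero hirr θ hw
  -- the carrier is non-zero: `θ̄ (mk Φ_f) ≠ 0`
  obtain ⟨x, hx⟩ : ∃ x, θ x ≠ 0 := ⟨_, hw⟩
  have hx0 : x ≠ 0 := fun h0 => hx (by rw [h0, map_zero])
  -- `finPart ∘ ιA ∘ (1,·) = (finAdelicCongr … g ht hg).symm`
  have key' : P.HasFinComponent
      ((rhoVAtLine (↥(maximalRealSubfield L)) L (IsCMField.complexConj L) 2 e₁ (Matrix.diagonal dV)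
          (complexConj_imagUnit L) (imagUnit_ne_zero L) (imagUnit_mul_self L) (realDiagonal_isSymm L dV hdV)
          (isUnit_det_realDiagonal L dV hdV hdV0) (realDiagonal_map L dV hdV).symm
          (fun a => isCompatible_chiSplittingLine L e₁ dV hdV hdV0 (toHeckeCharacter L μ')
            (isUnitary_toHeckeCharacter L μ') ((isOscillatorChar_toHeckeCharacter_iff μ').mpr hμ')
            (TW (↥(maximalRealSubfield L)) a) (isSymm_TW (↥(maximalRealSubfield L)) a)
            (isUnit_det_TW (↥(maximalRealSubfield L)) a) (JW (↥(maximalRealSubfield L)) L a)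
            (JW_eq (↥(maximalRealSubfield L)) L a)) a' χ').comp
        ((finPart (↥(maximalRealSubfield L)) L (IsCMField.complexConj L) 2 (Matrix.diagonal dV)).comp
          (ιA.comp (finAdelicToAdelic (↥(maximalRealSubfield L)) L (IsCMField.complexConj L) 2 H)))) := key
  rw [hιV] at key'
  exact ⟨χ', nontrivial_of_ne x 0 hx0, key'⟩

end Summit.HodgeConjecture.HodgeConjecture.Cruxes.HLiu418.F0LD2ThetaFinComponent

end
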